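import Summits.ABC.IUTFork.Conditional.WRowLicenceOrbitEventuallySharp
import Summits.ABC.IUTFork.Conditional.WRowPerImageTripleEventuallySharp
import HarnessLib

/-!
# Branch C / R-W, reading (P): the PER-IMAGE Corollary and the SLOT licence at EVERY genuine Θ-datum over EVERY RATIONAL point of the S₃-orbit
# of an abc-triple Frey point beyond the SHARP level (abc-iut cell, branch C, row «ORBIT», reading-(P) companion of p524300 / p512345; seat
# abc-iut-C-cert-2 gen 7)

Record-only PROOF file (D-0012; 0 definitions, 0 `Prop` facts, nothing re-typed) of the abc-iut cell. TAKES NO SIDE on [IUTchIII] Cor. 3.12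
(S. Mochizuki, *Inter-universal Teichmüller theory III*, Cor. 3.12 p. 173–174; Step (xi-f) p. 184), on (U)/(P), or on any author.

p524300 (`WRowLicenceOrbitEventuallySharp`) gives the (U) licence and `T.Cor312Of` at every genuine datum over every rational `q` with
`j(q) = j(a/c)` beyond the sharp level. A rational point has `d_mod = 1`, where the per-image Corollary IS the (U) one (abc-iut-c312-d1
`DHData.cor312Of_iff_perImage_of_finrank_eq_one`) and the slot licence IS the union licence for realising ideles
(`Cor312Prov.slotLicence_iff_licence_settingPrVolSharp_pilotDataOfK_of_finrank_eq_one_of_isVolumeInputOf`) — exactly as in p512345 at `q = a/c`: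

* **`WRow.cor312PerImageOf_orbit_of_primePow_lt`** — `T.Cor312PerImageOf` at every genuine datum over every rational `q` with `j(q) = j(a/c)`,
  every prime `l ≥ 5` with `p < l ∧ 4·p^{⌊v_p(abc)/2⌋} < l` for every odd `p ∣ abc`;
* **`WRow.slotLicence_orbit_of_primePow_lt`** — the SLOT licence of the sharp K-setting there, for every pair of realising ideles.

READING: the γ / joint books' antecedent `¬ SlotLicence` and the (P) conclusions behave at every rational point of `U_X` as at the Frey point of its
triple. HONEST SCOPE as in p512345: via `d_mod = 1`, NOT via «hull ⇒ per-image»; typed ≠ proved; instantiated ≠ endorsed; no abc claim.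
[cite: Mochizuki2012, IUTchI Def. 3.1 (b),(c) pp. 61–62; IUTchIII Cor. 3.12 p. 173–174, Step (xi-f) p. 184; IUTchIV Thm. 1.10 p. 22,
Prop. 1.2 (i)(ii) p. 10, Prop. 1.4 (ii) p. 13] [cite: DupuyHilado2025, §3.3, §3.9, §4.9, §4.12] [claim: Mochizuki2012, status: disputed]
for every IUT sentence. PROOF-ONLY: no definitions.
-/

noncomputable section

open Set Function NumberField IsDedekindDomain

namespace Summit.ABC.IUTFork.Conditional

open Thm311 Thm311.Real Cor312 Cor312Vol Cor312Prov Literature.IUT.LogThetaLattice Literature.IUT.LogVolume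
  Literature.IUT.HodgeTheaters Literature.IUT.LogVolume.ThetaData Literature.IUT.LogVolume.Cor22
open Literature.NumberTheory.NumberFields Literature.NumberTheory.GaloisRepresentations.Ultrametric
open Literature.NumberTheory.DiophantineGeometry Literature.NumberTheory.DiophantineGeometry.GenEll Summit.ABC.ABC.Theorems

/-- **`T.Cor312PerImageOf` (READING (P)) at EVERY genuine Θ-datum over EVERY rational `q` with `j(q) = j(a/c)`, EVERY prime `l ≥ 5` above the odd
bad primes and their `4·p^{⌊v_p(abc)/2⌋}`** — p524300's `WRow.cor312Of_orbit_of_primePow_lt` and the degree-one identity of the two readings.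
[cite: Mochizuki2012, IUTchIII Cor. 3.12 p. 173–174; IUTchIV Thm. 1.10 p. 22] [claim: Mochizuki2012, status: disputed] -/
theorem WRow.cor312PerImageOf_orbit_of_primePow_lt {a b c l : ℕ} (habc : IsABCTriple a b c) {q : ℚ}
    (hq : Cor22.jInv q = Cor22.jInv ((a : ℚ) / c)) (hl : l.Prime) (hl5 : 5 ≤ l)
    (hbad : ∀ p : ℕ, p.Prime → p ∣ a * b * c → p ≠ 2 → p < l ∧ 4 * p ^ ((a * b * c).factorization p / 2) < l)
    (T : Cor22.ThetaVolumeDatumAt (ratPoint q) l) : T.Cor312PerImageOf := by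
  letI := T.instFieldF; letI := T.instNumberFieldF; letI := T.instAlgebraF; letI := T.instFieldK
  letI := T.instNumberFieldK; letI := T.instAlgebraK; letI := T.instFieldFbar; letI := T.instAlgebraFbar
  letI := T.instAlgebraKFbar; letI := T.instIsElliptic
  have hF : Module.finrank ℚ (fieldOfModuli T.E) = 1 :=
    T.finrank_rat_fieldOfModuli_eq_dmod.trans (Cor22.dmod_eq_one_of_degree_le_one (le_of_eq (degree_ratPoint _)))
  exact (DHData.cor312Of_iff_perImage_of_finrank_eq_one T.I hF).mp (WRow.cor312Of_orbit_of_primePow_lt habc hq hl hl5 hbad T)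

/-- **THE SLOT LICENCE of OUR sharp K-setting at EVERY genuine Θ-datum over EVERY rational `q` with `j(q) = j(a/c)`, beyond the sharp level**,
for every pair of realising ideles — p524300's orbit licence and the degree-one identity of slot and union licences. [cite: Mochizuki2012,
IUTchI Def. 3.1 (b),(c) pp. 61–62; IUTchIII Cor. 3.12 Step (xi-f) p. 184; IUTchIV Prop. 1.2 (i)(ii) p. 10] [cite: DupuyHilado2025, §3.3, §3.9,
§4.9, §4.12] [claim: Mochizuki2012, status: disputed] -/
theorem WRow.slotLicence_orbit_of_primePow_lt {a b c l : ℕ} (habc : IsABCTriple a b c) {q : ℚ}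
    (hq : Cor22.jInv q = Cor22.jInv ((a : ℚ) / c))
    (hl : l.Prime) (hl5 : 5 ≤ l)
    (hbad : ∀ p : ℕ, p.Prime → p ∣ a * b * c → p ≠ 2 → p < l ∧ 4 * p ^ ((a * b * c).factorization p / 2) < l)
    (T : Cor22.ThetaVolumeDatumAt (ratPoint q) l) :
    letI := T.instFieldF; letI := T.instNumberFieldF; letI := T.instAlgebraF; letI := T.instFieldK
    letI := T.instNumberFieldK; letI := T.instAlgebraK; letI := T.instFieldFbar; letI := T.instAlgebraFbar
    letI := T.instAlgebraKFbar; letI := T.instIsElliptic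
    ∀ {logv : PadicLogs T.K} (hlog : LogvAnalytic logv) (M : Type) [Field M] [NumberField M]
      (archPk : ∀ (j : (thetaIndex (pilotDataOfK T.D T.K)).Label) (vQ : (thetaIndex (pilotDataOfK T.D T.K)).VQ),
        Set ((logShellsDH (pilotDataOfK T.D T.K) logv).Packet j vQ))
      (archSub : ∀ (j : (thetaIndex (pilotDataOfK T.D T.K)).Label) (v : (thetaIndex (pilotDataOfK T.D T.K)).V),
        Set ((logShellsDH (pilotDataOfK T.D T.K) logv).Packet j ((thetaIndex (pilotDataOfK T.D T.K)).over v)))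
      (Ψ : ℤ → ∀ v : (thetaIndex (pilotDataOfK T.D T.K)).V, v ∈ (thetaIndex (pilotDataOfK T.D T.K)).Vbad →
        Set ((logShellsDH (pilotDataOfK T.D T.K) logv).StarPacket v))
      (act : ℤ → ∀ v : (thetaIndex (pilotDataOfK T.D T.K)).V, v ∈ (thetaIndex (pilotDataOfK T.D T.K)).Vbad →
        (logShellsDH (pilotDataOfK T.D T.K) logv).StarPacket v → Module.End ℚ ((logShellsDH (pilotDataOfK T.D T.K) logv).StarPacket v))
      (Mmod : ℤ → ∀ j : (thetaIndex (pilotDataOfK T.D T.K)).LabelStar, Set ((logShellsDH (pilotDataOfK T.D T.K) logv).GlobalPacket j.1))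
      (region : ℤ → ∀ j : (thetaIndex (pilotDataOfK T.D T.K)).LabelStar, FinDivisor M → ∀ vQ : (thetaIndex (pilotDataOfK T.D T.K)).VQ,
        Set ((logShellsDH (pilotDataOfK T.D T.K) logv).Packet j.1 vQ))
      (n : ℤ) {HT : Type} {LogLink : HT → HT → Type} {IsFull : ∀ {s t : HT}, LogLink s t → Prop}
      (lat : LGPGaussianLogThetaLattice LogLink IsFull)
      {Frd : Type} {IsoF : Frd → Frd → Type} {Ob : Frd → Type} {realify : Frd → Frd} {Strip : Type}
      {IsoS : Strip → Strip → Type} {Mv : ∀ v : (thetaIndex (pilotDataOfK T.D T.K)).V, v ∈ (thetaIndex (pilotDataOfK T.D T.K)).Vbad → Type}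
      [∀ v h, Monoid (Mv v h)]
      (sig : GlobalLGPFrobenioidSignature (thetaIndex (pilotDataOfK T.D T.K)).lstar (thetaIndex (pilotDataOfK T.D T.K)).V
        (· ∈ (thetaIndex (pilotDataOfK T.D T.K)).Vbad) Frd IsoF Ob realify Strip IsoS Mv)
      (split : SplittingMonoids Mv) {ObΔ : Type} {N : ∀ v : (thetaIndex (pilotDataOfK T.D T.K)).V, v ∈ (thetaIndex (pilotDataOfK T.D T.K)).Vbad → Type}
      [∀ v h, Monoid (N v h)] (qData : QPilotData ObΔ N)
      (tq : ∀ (pp : Nat.Primes) (x : (thetaIndex (pilotDataOfK T.D T.K)).Fibre (.inr pp)),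
        haveI : Fact (pp : ℕ).Prime := ⟨pp.2⟩; kOf (pilotDataOfK T.D T.K) pp.1 x)
      (t : ∀ (pp : Nat.Primes) (_ : Fin (pilotDataOfK T.D T.K).lstar) (x : (thetaIndex (pilotDataOfK T.D T.K)).Fibre (.inr pp)),
        haveI : Fact (pp : ℕ).Prime := ⟨pp.2⟩; kOf (pilotDataOfK T.D T.K) pp.1 x)
      (htq0 : ∀ pp x, tq pp x ≠ 0)
      (htq1 : ∀ (pp : Nat.Primes) (x : (thetaIndex (pilotDataOfK T.D T.K)).Fibre (.inr pp)),
        haveI : Fact (pp : ℕ).Prime := ⟨pp.2⟩; placeOf (pilotDataOfK T.D T.K) pp.1 x ∉ (pilotDataOfK T.D T.K).S → ‖tq pp x‖ = 1)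
      (_ht0 : ∀ pp i x, t pp i x ≠ 0)
      (_ht : ∀ (pp : Nat.Primes) (i : Fin (pilotDataOfK T.D T.K).lstar) (x : (thetaIndex (pilotDataOfK T.D T.K)).Fibre (.inr pp)),
        haveI : Fact (pp : ℕ).Prime := ⟨pp.2⟩
        Real.log ‖t pp i x‖ = -((pilotDataOfK T.D T.K).thetaPilot i (placeOf (pilotDataOfK T.D T.K) pp.1 x)) *
          logNorm T.K (placeOf (pilotDataOfK T.D T.K) pp.1 x) / localDegree T.K (placeOf (pilotDataOfK T.D T.K) pp.1 x))
      (_htq : ∀ (pp : Nat.Primes) (x : (thetaIndex (pilotDataOfK T.D T.K)).Fibre (.inr pp)),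
        haveI : Fact (pp : ℕ).Prime := ⟨pp.2⟩
        Real.log ‖tq pp x‖ = -((pilotDataOfK T.D T.K).qPilot (placeOf (pilotDataOfK T.D T.K) pp.1 x)) *
          logNorm T.K (placeOf (pilotDataOfK T.D T.K) pp.1 x) / localDegree T.K (placeOf (pilotDataOfK T.D T.K) pp.1 x)),
      (settingPrVolSharp (pilotDataOfK T.D T.K) hlog M archPk archSub Ψ act Mmod region n lat sig split qData tq t htq0 htq1).SlotLicence := by
  letI := T.instFieldF; letI := T.instNumberFieldF; letI := T.instAlgebraF; letI := T.instFieldK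
  letI := T.instNumberFieldK; letI := T.instAlgebraK; letI := T.instFieldFbar; letI := T.instAlgebraFbar
  letI := T.instAlgebraKFbar; letI := T.instIsElliptic
  intro logv hlog M _ _ archPk archSub Ψ act Mmod region n HT LogLink IsFull lat Frd IsoF Ob realify Strip IsoS Mv _ sig split ObΔ N _
    qData tq t htq0 htq1 ht0 ht htq
  have hF : Module.finrank ℚ (fieldOfModuli T.E) = 1 :=
    T.finrank_rat_fieldOfModuli_eq_dmod.trans (Cor22.dmod_eq_one_of_degree_le_one (le_of_eq (degree_ratPoint _)))
  exact (Cor312Prov.slotLicence_iff_licence_settingPrVolSharp_pilotDataOfK_of_finrank_eq_one_of_isVolumeInputOf T.D t hlog M archPk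
    archSub Ψ act Mmod region n lat sig split qData tq htq0 htq1 T.isVolumeInputOf ht0 ht hF).2
    (WRow.licence_orbit_of_primePow_lt habc hq hl hl5 hbad T hlog M archPk archSub Ψ act Mmod region n lat sig split qData tq t htq0
      htq1 ht0 ht htq)

end Summit.ABC.IUTFork.Conditional

end
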